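import Mathlib.Tactic.Linarith
import Mathlib.Tactic.Positivity
import Mathlib.Tactic.Ring
import Mathlib.Tactic.Zify
import Mathlib.Tactic.Push
import HarnessLib

/-!
# Roy–Waldschmidt 1997, §6 (iv) (b): Théorème 1.1 from Énoncé 2 — the arithmetic

D. Roy, M. Waldschmidt, Ann. Sci. ÉNS (4) 30 (1997) 753–796, §6 (iv) (b), pp. 789–790.  With
`ε = 1/N`, `N = 2d(d + ℓ₁) + 1`, the object `X = (d₀, d₁, W, Y, Y_a)` of Théorème 1.1 lies in
`𝒞_ε` and `b_ε(X) > 0`; for a minimiser `s : X → X'` of `a_ε/b_ε` with `r_ε(X')` minimal one has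
`κ(X') = κ_a(X') = 0` (Lemme 6.4) and (6.5) `a(X)/b(X) ≥ a(X')/b(X') ≥ c(X')/d(X')`, i.e.
`d₁/((d-2n)+ε(n-d₀)) ≥ d₁'/((d'-2n')+ε(n'-d₀')) ≥ ℓ₁'/((2n'-ℓ₀')+ε(ℓ₀'-n')-ε²ℓ_a')`; "en vertu du
choix de `ε`, puisque `d₁' > 0`, l'inégalité de gauche entraîne `d' > 2n'` et
`d₁/(d-2n) ≥ d₁'/(d'-2n')`" (an integrality argument: the `ε`-terms are `< 1` in absolute value
after clearing denominators), "comme `ε(n'-d₀') ≥ 0` et `ε(ℓ₀'-n') - ε²ℓ_a' ≤ 0`, celle de droite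
livre `d₁'/(d'-2n') ≥ ℓ₁'/(2n'-ℓ₀')` avec l'inégalité stricte si `n' > d₀'` ou `n' > ℓ₀'` ou
`ℓ_a' > 0`".

This file PROVES these two arithmetic steps in integer form (`left_ineq_6_5`, `right_ineq_6_5`)
and the positivity facts `b_ε(X) > 0` (`bE_pos_of_two_nn_lt`), `d' ≥ 2n'`/`d₁' ≥ n' > 0` from
`b_ε(X') > 0` (`dims_of_bE_pos`).  The geometric part of (iv) (b) and the assembly are in
`…Sec6Thm11.lean`.  No definitions, no named facts.

## References

* [RoyWaldschmidt1997ENS] D. Roy, M. Waldschmidt, Ann. Sci. ÉNS (4) 30 (1997) 753–796, §6 (iv) (b),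
  pp. 789–790 (read on the rendered scan).
-/

namespace Literature.NumberTheory.Transcendental

namespace RoyWaldschmidt1997

/-- **`b_ε(X) > 0` for the object of Théorème 1.1** (`d > 2n`, `N ≥ d + 1`):
`(2N²-N)n < (N²-N)d₀ + N²d₁` (p. 789: "l'hypothèse `d > 2n` implique `b_ε(X) > 0`"). [folklore] -/
theorem bE_pos_of_two_nn_lt {N d₀ d₁ n : ℕ} (hn : 2 * n < d₀ + d₁) (hN : d₀ + d₁ + 1 ≤ N) :
    (2 * N ^ 2 - N) * n < (N ^ 2 - N) * d₀ + N ^ 2 * d₁ := by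
  have hN1 : 1 ≤ N := by omega
  have hNN : N ≤ N ^ 2 := by nlinarith
  have hNN2 : N ≤ 2 * N ^ 2 := by nlinarith
  zify [hNN, hNN2]
  have h1 : (2 * (n : ℤ) + 1) ≤ d₀ + d₁ := by exact_mod_cast hn
  have h2 : ((d₀ : ℤ) + d₁ + 1) ≤ N := by exact_mod_cast hN
  have hn0 : (0 : ℤ) ≤ n := by positivity
  have hd0 : (0 : ℤ) ≤ d₀ := by positivity
  have hNN' : (0 : ℤ) ≤ (N : ℤ) ^ 2 - N := by
    have : ((N : ℕ) : ℤ) ≤ ((N ^ 2 : ℕ) : ℤ) := by exact_mod_cast hNN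
    push_cast at this; linarith
  nlinarith [mul_le_mul_of_nonneg_left h1 hNN',
    mul_le_mul_of_nonneg_left h2 (by positivity : (0 : ℤ) ≤ (N : ℤ)), mul_nonneg hn0 hd0]

/-- **Dimensions from `b_ε(X') > 0` with `κ_a(X') = 0`** (p. 790): if
`(2N²-N)n' < (N²-N)d₀' + N²d₁'`, `d₀' ≤ n'`, `0 < n'`, `d₀' + d₁' < N` then `2n' ≤ d₀' + d₁'` and
`n' ≤ d₁'` ("la condition `b_ε ≠ 0` signifie `(d'-2n') + ε(n'-d₀') > 0`, donc `d' ≥ 2n'`. Comme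
`n' ≥ d₀'`, on en déduit `d₁' ≥ n' > 0`"). [cite: RoyWaldschmidt1997ENS, §6 (iv) (b), p. 790] -/
theorem dims_of_bE_pos {N d₀' d₁' n' : ℕ} (hb : (2 * N ^ 2 - N) * n' < (N ^ 2 - N) * d₀' + N ^ 2 * d₁')
    (hd₀' : d₀' ≤ n') (hN : d₀' + d₁' < N) : 2 * n' ≤ d₀' + d₁' ∧ n' ≤ d₁' := by
  have hN1 : 1 ≤ N := by omega
  have hNN : N ≤ N ^ 2 := by nlinarith
  have hNN2 : N ≤ 2 * N ^ 2 := by nlinarith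
  have key : 2 * n' ≤ d₀' + d₁' := by
    by_contra h
    push Not at h
    -- `d' + 1 ≤ 2n'`: then `N²(d'+1) ≤ 2N²n'`, contradiction with `hb` and `N d' < N²`
    zify [hNN, hNN2] at hb
    have h1 : ((d₀' : ℤ) + d₁' + 1) ≤ 2 * n' := by exact_mod_cast h
    have h2 : ((d₀' : ℤ) + d₁' + 1) ≤ N := by exact_mod_cast hN
    have h3 : (d₀' : ℤ) ≤ n' := by exact_mod_cast hd₀'
    nlinarith [mul_le_mul_of_nonneg_left h1 (by positivity : (0 : ℤ) ≤ (N : ℤ) ^ 2),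
      mul_le_mul_of_nonneg_left h2 (by positivity : (0 : ℤ) ≤ (N : ℤ))]
  exact ⟨key, by omega⟩

/-- **The left inequality of (6.5) unwound** (p. 790): from `a(X')·b(X) ≤ a(X)·b(X')` in integer
form, i.e. `d₁'·B ≤ d₁·B₁` with `B ≥ N²(d-2n) + N(n-d₀)` (`= N²b(X)` up to the terms `-N²κ` in `a`
and `+κ_a` in `b`, which only help) and `B₁ = N²(d'-2n') + N(n'-d₀')`, and `N > 2d²`, one gets
`d₁'(d-2n) ≤ d₁(d'-2n')`, hence `d' > 2n'` when `d₁' > 0`, `d > 2n`.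
[cite: RoyWaldschmidt1997ENS, §6 (iv) (b), p. 790] -/
theorem left_ineq_6_5 {N d₀ d₁ n d₀' d₁' n' : ℤ} (hN : 2 * (d₀ + d₁) ^ 2 < N)
    (hd₀ : 0 ≤ d₀) (hd₁ : 0 ≤ d₁) (hn : 0 ≤ n) (hd₀' : 0 ≤ d₀') (hd₁' : 0 < d₁')
    (h2n : 2 * n < d₀ + d₁) (hd' : d₀' + d₁' ≤ d₀ + d₁) (hn'd : n' ≤ d₀' + d₁')
    (hineq : d₁' * (N ^ 2 * (d₀ + d₁ - 2 * n) + N * (n - d₀)) ≤ d₁ * (N ^ 2 * (d₀' + d₁' - 2 * n') + N * (n' - d₀'))) :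
    d₁' * (d₀ + d₁ - 2 * n) ≤ d₁ * (d₀' + d₁' - 2 * n') ∧ 2 * n' < d₀' + d₁' := by
  have hN0 : 0 < N := by nlinarith
  -- `N² A ≤ N (d₁ n' + d₁' d₀) ≤ N · 2d² < N²`
  set A := d₁' * (d₀ + d₁ - 2 * n) - d₁ * (d₀' + d₁' - 2 * n') with hA
  have h1 : N ^ 2 * A ≤ N * (d₁ * n' + d₁' * d₀) := by
    have : N ^ 2 * A = d₁' * (N ^ 2 * (d₀ + d₁ - 2 * n)) - d₁ * (N ^ 2 * (d₀' + d₁' - 2 * n')) := by rw [hA]; ring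
    nlinarith [mul_nonneg hd₁ hd₀', mul_nonneg hd₁'.le hn]
  have h2 : d₁ * n' + d₁' * d₀ ≤ 2 * (d₀ + d₁) ^ 2 := by nlinarith
  have h3 : N ^ 2 * A < N ^ 2 * 1 := by nlinarith
  have hA0 : A ≤ 0 := by
    by_contra h; push Not at h
    have : N ^ 2 * 1 ≤ N ^ 2 * A := by nlinarith
    linarith
  have hmain : d₁' * (d₀ + d₁ - 2 * n) ≤ d₁ * (d₀' + d₁' - 2 * n') := by rw [hA] at hA0; linarith
  refine ⟨hmain, ?_⟩
  by_contra h; push Not at h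
  have : d₁ * (d₀' + d₁' - 2 * n') ≤ 0 := by nlinarith
  have : 0 < d₁' * (d₀ + d₁ - 2 * n) := by nlinarith
  linarith

/-- **The right inequality of (6.5) unwound** (p. 790): from `c(X')·b(X') ≤ a(X')·d(X')` in integer
form, `ℓ₁'·B₁ ≤ d₁'·D₁` with `B₁ = N²(d'-2n') + N(n'-d₀') ≥ N²(d'-2n')` and
`D₁ = N²(2n'-ℓ₀') - N(n'-ℓ₀') - ℓ_a' ≤ N²(2n'-ℓ₀')`, one gets `ℓ₁'(d'-2n') ≤ d₁'(2n'-ℓ₀')`, strictly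
if `n' > d₀'` or `n' > ℓ₀'` or `ℓ_a' > 0`. [cite: RoyWaldschmidt1997ENS, §6 (iv) (b), p. 790] -/
theorem right_ineq_6_5 {N d₀' d₁' n' ℓ₀' ℓ₁' ℓa' : ℤ} (hN : 1 ≤ N)
    (hd₁' : 0 < d₁') (hℓ₁' : 0 ≤ ℓ₁') (hℓa' : 0 ≤ ℓa')
    (hn'd₀' : d₀' ≤ n') (hℓ₀'n' : ℓ₀' ≤ n') (h2n' : 2 * n' < d₀' + d₁') (hn'pos : 0 < n')
    (hineq : ℓ₁' * (N ^ 2 * (d₀' + d₁' - 2 * n') + N * (n' - d₀')) ≤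
      d₁' * (N ^ 2 * (2 * n' - ℓ₀') - N * (n' - ℓ₀') - ℓa')) :
    ℓ₁' * (d₀' + d₁' - 2 * n') ≤ d₁' * (2 * n' - ℓ₀') ∧
      ((d₀' < n' ∨ ℓ₀' < n' ∨ 0 < ℓa') → ℓ₁' * (d₀' + d₁' - 2 * n') < d₁' * (2 * n' - ℓ₀')) := by
  have hB : N ^ 2 * (d₀' + d₁' - 2 * n') ≤ N ^ 2 * (d₀' + d₁' - 2 * n') + N * (n' - d₀') := by nlinarith
  have hD : N ^ 2 * (2 * n' - ℓ₀') - N * (n' - ℓ₀') - ℓa' ≤ N ^ 2 * (2 * n' - ℓ₀') := by nlinarith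
  have hpos : 0 < d₀' + d₁' - 2 * n' := by linarith
  have h1 : ℓ₁' * (N ^ 2 * (d₀' + d₁' - 2 * n')) ≤ d₁' * (N ^ 2 * (2 * n' - ℓ₀')) := by
    calc ℓ₁' * (N ^ 2 * (d₀' + d₁' - 2 * n')) ≤ ℓ₁' * (N ^ 2 * (d₀' + d₁' - 2 * n') + N * (n' - d₀')) :=
          mul_le_mul_of_nonneg_left hB hℓ₁'
      _ ≤ d₁' * (N ^ 2 * (2 * n' - ℓ₀') - N * (n' - ℓ₀') - ℓa') := hineq
      _ ≤ d₁' * (N ^ 2 * (2 * n' - ℓ₀')) := mul_le_mul_of_nonneg_left hD hd₁'.le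
  have hN2 : (0 : ℤ) < N ^ 2 := by positivity
  refine ⟨?_, fun hstrict => ?_⟩
  · have : N ^ 2 * (ℓ₁' * (d₀' + d₁' - 2 * n')) ≤ N ^ 2 * (d₁' * (2 * n' - ℓ₀')) := by nlinarith
    exact le_of_mul_le_mul_left this hN2
  · -- one of the slack terms is positive
    have h2 : ℓ₁' * (N ^ 2 * (d₀' + d₁' - 2 * n')) < d₁' * (N ^ 2 * (2 * n' - ℓ₀')) := by
      rcases hstrict with h | h | h
      · -- `B₁ > N²(d'-2n')`, useful when `ℓ₁' > 0`; when `ℓ₁' = 0` the right side is positive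
        rcases eq_or_lt_of_le hℓ₁' with h0 | h0
        · rw [← h0]; simp only [zero_mul]
          have : 0 < 2 * n' - ℓ₀' := by linarith
          positivity
        · have hB' : N ^ 2 * (d₀' + d₁' - 2 * n') < N ^ 2 * (d₀' + d₁' - 2 * n') + N * (n' - d₀') := by nlinarith
          calc ℓ₁' * (N ^ 2 * (d₀' + d₁' - 2 * n')) < ℓ₁' * (N ^ 2 * (d₀' + d₁' - 2 * n') + N * (n' - d₀')) :=
                mul_lt_mul_of_pos_left hB' h0
            _ ≤ d₁' * (N ^ 2 * (2 * n' - ℓ₀') - N * (n' - ℓ₀') - ℓa') := hineq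
            _ ≤ d₁' * (N ^ 2 * (2 * n' - ℓ₀')) := mul_le_mul_of_nonneg_left hD hd₁'.le
      · have hD' : N ^ 2 * (2 * n' - ℓ₀') - N * (n' - ℓ₀') - ℓa' < N ^ 2 * (2 * n' - ℓ₀') := by nlinarith
        calc ℓ₁' * (N ^ 2 * (d₀' + d₁' - 2 * n')) ≤ ℓ₁' * (N ^ 2 * (d₀' + d₁' - 2 * n') + N * (n' - d₀')) :=
              mul_le_mul_of_nonneg_left hB hℓ₁'
          _ ≤ d₁' * (N ^ 2 * (2 * n' - ℓ₀') - N * (n' - ℓ₀') - ℓa') := hineq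
          _ < d₁' * (N ^ 2 * (2 * n' - ℓ₀')) := mul_lt_mul_of_pos_left hD' hd₁'
      · have hD' : N ^ 2 * (2 * n' - ℓ₀') - N * (n' - ℓ₀') - ℓa' < N ^ 2 * (2 * n' - ℓ₀') := by nlinarith
        calc ℓ₁' * (N ^ 2 * (d₀' + d₁' - 2 * n')) ≤ ℓ₁' * (N ^ 2 * (d₀' + d₁' - 2 * n') + N * (n' - d₀')) :=
              mul_le_mul_of_nonneg_left hB hℓ₁'
          _ ≤ d₁' * (N ^ 2 * (2 * n' - ℓ₀') - N * (n' - ℓ₀') - ℓa') := hineq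
          _ < d₁' * (N ^ 2 * (2 * n' - ℓ₀')) := mul_lt_mul_of_pos_left hD' hd₁'
    have : N ^ 2 * (ℓ₁' * (d₀' + d₁' - 2 * n')) < N ^ 2 * (d₁' * (2 * n' - ℓ₀')) := by nlinarith
    exact lt_of_mul_lt_mul_left this hN2.le

end RoyWaldschmidt1997

end Literature.NumberTheory.Transcendental
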